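/-
Origin: expansion seat `planner-pub-hodgecm-mc-axioms-1-g12-0`, handover #3 2026-08-20T01:15Z md5 473f77077039960697ee2e557d226624 (442 l.) NEW additive leaf `CM/CommonReflexSpan.lean` — (J-Liu-iso) (L2): ns `HodgeCM.CM.CommonReflex`; `def complexify (ρ : K →ₐ[ℚ] Module.End ℚ V) : K →+* Module.End ℂ (ℂ ⊗[ℚ] V)` (+ `complexify_apply` rfl, `mem_eigenline_complexify_iff`, `eigenline_complexify_eq` (rfl; = the `Universe.eigenLine` shape), `baseChange_complexify_apply`), `exists_cmLinear_family_injective`, `map_mem_eigenline_comp`, `eigenline_mem_span_of_factorisation`, `map_eigenline_complexify`, `finrank_eigenline_complexify_eq_one`, `exists_basis_mem_eigenline_complexify`, `finite_bettiCohomology_of_realisation`, `exists_eq_sum_baseChange_of_bijective`, `eq_zero_of_forall_baseChange_eq_zero`, and (L2) `eigenline_le_span_pull_eigenline k₁ k₂ (hR) (hI) (hC : IsCMTypeRealisation Φ' C ιC θC) (hB) (hA) (hθC) (hθB) (hθA) (hστ : τ.comp k₂ = σ.comp k₁) : eigenline (complexify (cmAction θA hθA)) τ ≤ Submodule.span ℂ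 {x ∣ ∃ (u : A.X ⟶ B.X) β, β ∈ eigenline (complexify (cmAction θB hθB)) σ ∧ x = (pull u 1).baseChange ℂ β}`. Imports #2 only. KERNEL, trio. CERT rc 0 / 59 s / 0 warnings / 0 proof-hole (log cert-jliu-L1L2.log). (`HOME/mc/pub-hodgecm-mc-axioms-1-g12/lean/jliu/HodgeCM/CM/CommonReflexSpan.lean`, md5 473f77077039, 442 lines);
landed by the second packager (p2) in gate run 38 as `HodgeCM/CM/CommonReflexSpan.lean` (verbatim).
-/
/-
Copyright (c) 2026 the pub-hodgecm formalisation cell (harness21).  New file, not vendored.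
Origin: HOME/mc/pub-hodgecm-mc-axioms-1-g12/lean/jliu/HodgeCM/CM/CommonReflexSpan.lean — session
planner-pub-hodgecm-mc-axioms-1-g12-0 (unit pub-hodgecm-mc-axioms-1-g12, CONSTRUCTION PROVER gen 12 of lineage mc-axioms-1,
node N-i1 (L-lvl)), 2026-08-20.  Intended final place: `HodgeCM/CM/CommonReflexSpan.lean` (NEW additive leaf; imports
`HodgeCM.CM.CommonReflexHodgeMorphisms` only).  (J-Liu-iso) kernel, step (L2) of the axioms-1-g10 design memo
`HOME/mc/pub-hodgecm-mc-axioms-1-g10/notes/J-Liu-iso-memo.md` §3 (route R-down), in the TENSOR currency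
`ℂ ⊗_ℚ H¹(−; ℚ)` of the model universe (`Universe.CohC`, `Universe.pullC`, `Universe.eigenLine`).
-/
import Summits.HodgeConjecture.HodgeCM.CM.CommonReflexHodgeMorphisms

set_option autoImplicit false

/-!
# The isotypic block of a common-reflex CM realisation is swept by pull-backs of one eigenline

KERNEL (folklore linear algebra + Riemann's fullness as a hypothesis).  Setting of
`HodgeCM.CM.CommonReflexHodgeMorphisms`: a CM pair `(M', Φ')`, ring maps `k₁ : M' → K`, `k₂ : M' → M` of CM number
fields, realisations `(B, ι_B, θ_B)` of `Φ'^K = inducedCMType k₁ Φ'`, `(A, ι_A, θ_A)` of `Φ'^M = inducedCMType k₂ Φ'`, and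
ALSO a realisation `(C, ι_C, θ_C)` of the base pair `(M', Φ')` itself.  For embeddings `σ : K → ℂ`, `τ : M → ℂ` with the
same restriction `τ ∘ k₂ = σ ∘ k₁` to `M'`:

  (L2) `eigenline_le_span_pull_eigenline`: the `τ`-eigenline of `ℂ ⊗_ℚ H¹(A(ℂ); ℚ)` (for the complexified rational
  CM action `complexify (cmAction θ_A)`) lies in the `ℂ`-span of the pull-backs `(u^*)_ℂ β` of `σ`-eigenvectors
  `β ∈ ℂ ⊗_ℚ H¹(B(ℂ); ℚ)` along morphisms `u : A → B` of the underlying varieties.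

Proof.  (1) Riemann's fullness read through the tree's type-inflation kernel (`thm3_rational_of_riemann`, for
`k₂ : M' → M`) gives morphisms `p_j : A → C` whose pull-backs `H¹(C; ℚ)^m → H¹(A; ℚ)` are jointly bijective and
`M'`-equivariant; (2) `M'`-linear coordinate maps `λ_l : H¹(B; ℚ) → H¹(C; ℚ)` (jointly injective,
`exists_cmLinear_family_injective`) are Hodge (`commonReflex_isHodgeMorphismOne` with `k₂ = id`), so fullness gives
`r_l : C → B` with `r_l^* = n_l λ_l`; (3) over `ℂ`: a `τ`-eigenvector `x` is `Σ_j (p_j^*)_ℂ γ_j`; only the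
`χ := σ ∘ k₁`-components of the `γ_j` contribute (eigen-coordinates, `repr_apply_eq_zero_of_comp_ne`), the `χ`-eigenline of
`C` is a line containing the nonzero `(r_l^*)_ℂ β` for some `l`, hence `x = Σ_j d_j (p_j^*)_ℂ (r_l^*)_ℂ β =
Σ_j d_j ((p_j ≫ r_l)^*)_ℂ β` (`eigenline_mem_span_of_factorisation`, `BettiUniverse.pull_comp`).

USE (J-Liu-iso, route R-down).  With `B := A_{(K,Ψ_i)}` (the universe's `cmAV c.K (c.Ψ i)`), `A :=` Liu's `A_μ ⊗ ℂ`,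
`C :=` a realisation of the reflex pair, `σ := c.σ`: a theta class `ω = Σ_ℓ c_ℓ (f_ℓ^*)_ℂ α♭` with `α♭` in the
`τ'`-eigenline of `A` becomes `Σ c_ℓ d_j ((f_ℓ ≫ u_j)^*)_ℂ β ∈ Universe.Uiso Γ c.K (c.Ψ i) c.σ`.  Hypotheses consumed:
E's binders `hR : DeligneMilne1982_Thm_6_20_full`, `hI : hodgePQ_independent_of_hodgeModel`; nothing of PerL / [QW8] /
the 2001 programme is used or asserted.
-/

noncomputable section

open scoped TensorProduct
open NumberField CategoryTheory Module

namespace HodgeCM.CM.CommonReflex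

open Literature.AlgebraicGeometry.Motives (SchemeOver IsSmoothProjective CMType AbelianVariety bettiCohomology
  ofRatClassBaseChange ComplexPoints)
open Literature.AlgebraicGeometry.HodgeTheory (complexBetti IsOfHodgeType HodgeModel ofRatClassBaseChangeEquiv
  hodgePQ_independent_of_hodgeModel IsHodgeMorphismOne DeligneMilne1982_Thm_6_20_full)
open Literature.AlgebraicGeometry.HodgeTheory.BettiUniverse (pull pull_comp cmAction IsInducedOnIntegers
  ofRatClassBaseChange_cmAction finrank_bettiCohomology_eq)
open Literature.AlgebraicGeometry.ComplexMultiplication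
open Literature.NumberTheory.Automorphic.PicardCM (eigenline)
open Literature.NumberTheory.ComplexMultiplication (inducedCMType mem_inducedCMType_iff inducedCMType_id)

/-! ## A. Linear algebra -/

section Complexify

variable {K : Type} [Field K] [NumberField K] {V : Type*} [AddCommGroup V] [Module ℚ V]

/-- The complexification `a ↦ ρ(a) ⊗ 1_ℂ` of a rational action `ρ : K → End_ℚ V`, as a ring homomorphism
`K → End_ℂ (ℂ ⊗_ℚ V)` (the shape `Universe.eigenLine` is written in). [folklore] -/
def complexify (ρ : K →ₐ[ℚ] Module.End ℚ V) : K →+* Module.End ℂ (ℂ ⊗[ℚ] V) where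
  toFun a := (ρ a).baseChange ℂ
  map_one' := by
    rw [map_one, Module.End.one_eq_id, LinearMap.baseChange_id]; rfl
  map_mul' a b := by
    rw [map_mul, Module.End.mul_eq_comp, LinearMap.baseChange_comp, ← Module.End.mul_eq_comp]
  map_zero' := by rw [map_zero, LinearMap.baseChange_zero]
  map_add' a b := by rw [map_add, LinearMap.baseChange_add]

/-- (Ported verbatim from the HodgeCMPerL package; no docstring in the source.) -/
@[simp] theorem complexify_apply (ρ : K →ₐ[ℚ] Module.End ℚ V) (a : K) :
    complexify ρ a = (ρ a).baseChange ℂ := rfl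

/-- Membership in a `σ`-eigenline of the complexified action, unfolded. [folklore] -/
theorem mem_eigenline_complexify_iff (ρ : K →ₐ[ℚ] Module.End ℚ V) (σ : K →+* ℂ) (t : ℂ ⊗[ℚ] V) :
    t ∈ eigenline (complexify ρ) σ ↔ ∀ a : K, (ρ a).baseChange ℂ t = σ a • t := by
  simp only [eigenline, Submodule.mem_iInf, Module.End.mem_eigenspace_iff, complexify_apply]

/-- `Universe.eigenLine`-shape: the eigenline of `complexify ρ` IS the joint eigenspace of the maps
`(ρ e) ⊗ 1_ℂ`. [folklore] -/
theorem eigenline_complexify_eq (ρ : K →ₐ[ℚ] Module.End ℚ V) (σ : K →+* ℂ) :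
    eigenline (complexify ρ) σ = ⨅ e : K, Module.End.eigenspace ((ρ e).baseChange ℂ) (σ e) := rfl

variable {K' : Type} [Field K'] [NumberField K'] {V' : Type*} [AddCommGroup V'] [Module ℚ V']

/-- **Complexified equivariance.** If `ψ ∘ ρ(a) = ρ′(a′) ∘ ψ` on `V`, then `ψ_ℂ ∘ (ρ(a) ⊗ 1) = (ρ′(a′) ⊗ 1) ∘ ψ_ℂ`.
[folklore] -/
theorem baseChange_complexify_apply (ρ : K →ₐ[ℚ] Module.End ℚ V) (ρ' : K' →ₐ[ℚ] Module.End ℚ V')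
    (ψ : V →ₗ[ℚ] V') {a : K} {a' : K'} (h : ∀ v, ψ (ρ a v) = ρ' a' (ψ v)) (t : ℂ ⊗[ℚ] V) :
    ψ.baseChange ℂ (complexify ρ a t) = complexify ρ' a' (ψ.baseChange ℂ t) := by
  have hc : ψ ∘ₗ (ρ a : V →ₗ[ℚ] V) = (ρ' a' : V' →ₗ[ℚ] V') ∘ₗ ψ := LinearMap.ext h
  rw [complexify_apply, complexify_apply, ← LinearMap.comp_apply (f := ψ.baseChange ℂ),
    ← LinearMap.baseChange_comp, hc, LinearMap.baseChange_comp, LinearMap.comp_apply]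

end Complexify

section Family

variable {K : Type} [Field K] [NumberField K]
  {V V' : Type*} [AddCommGroup V] [Module ℚ V] [AddCommGroup V'] [Module ℚ V']

/-- **Jointly injective equivariant maps INTO a `K`-line.** If a number field `K` acts `ℚ`-linearly on
finite-dimensional `ℚ`-spaces `V`, `V′` with `dim_ℚ V = [K:ℚ]`, there are finitely many `K`-equivariant `ℚ`-linear maps
`λ_l : V′ → V` with `⋂_l ker λ_l = 0` (the `K`-coordinates of `V′ ≅ K^m` times a generator of the `K`-line `V`).
Companion of the vendored `exists_cmLinear_sum_bijective` (maps OUT of the line). [folklore] -/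
theorem exists_cmLinear_family_injective [Module.Finite ℚ V] [Module.Finite ℚ V']
    (ρ : K →ₐ[ℚ] Module.End ℚ V) (ρ' : K →ₐ[ℚ] Module.End ℚ V')
    (hV : Module.finrank ℚ V = Module.finrank ℚ K) :
    ∃ (m : ℕ) (lam : Fin m → (V' →ₗ[ℚ] V)),
      (∀ v' : V', (∀ l, lam l v' = 0) → v' = 0) ∧
      ∀ (l : Fin m) (a : K) (v' : V'), lam l (ρ' a v') = ρ a (lam l v') := by
  letI instKV : Module K V := Module.compHom V ρ.toRingHom
  letI instKV' : Module K V' := Module.compHom V' ρ'.toRingHom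
  have hsmul : ∀ (a : K) (v : V), a • v = ρ a v := fun _ _ ↦ rfl
  have hsmul' : ∀ (a : K) (v : V'), a • v = ρ' a v := fun _ _ ↦ rfl
  haveI : IsScalarTower ℚ K V :=
    ⟨fun q a v ↦ by rw [hsmul, hsmul, map_smul, LinearMap.smul_apply]⟩
  haveI : IsScalarTower ℚ K V' :=
    ⟨fun q a v ↦ by rw [hsmul', hsmul', map_smul, LinearMap.smul_apply]⟩
  haveI : Module.Finite K V := Module.Finite.of_restrictScalars_finite ℚ K V
  haveI : Module.Finite K V' := Module.Finite.of_restrictScalars_finite ℚ K V'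
  have h1 : Module.finrank K V = 1 := by
    have hmul := Module.finrank_mul_finrank ℚ K V
    rw [hV] at hmul
    exact Nat.eq_of_mul_eq_mul_left Module.finrank_pos (by rw [mul_one]; exact hmul)
  let bV : Basis (Fin 1) K V := Module.finBasisOfFinrankEq K V h1
  let bV' : Basis (Fin (Module.finrank K V')) K V' := Module.finBasis K V'
  -- the `K`-linear maps `v′ ↦ (l-th coordinate of v′) • b_0`
  let L : Fin (Module.finrank K V') → (V' →ₗ[K] V) := fun l ↦
    (LinearMap.toSpanSingleton K V (bV 0)) ∘ₗ (bV'.coord l)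
  refine ⟨Module.finrank K V', fun l ↦ (L l).restrictScalars ℚ, fun v' hv' ↦ ?_, fun l a v' ↦ ?_⟩
  · -- all coordinates of `v′` vanish
    have hc : ∀ l, bV'.coord l v' = 0 := fun l ↦ by
      have h0 : bV'.coord l v' • bV 0 = 0 := by
        simpa [L, LinearMap.toSpanSingleton_apply] using hv' l
      exact (smul_eq_zero.1 h0).resolve_right (bV.ne_zero 0)
    exact bV'.forall_coord_eq_zero_iff.1 hc
  · change L l (ρ' a v') = ρ a (L l v')
    rw [← hsmul, ← hsmul', map_smul]

end Family

section Assembly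

variable {M' K M : Type} [Field M'] [NumberField M'] [Field K] [Field M] [NumberField M]
  {WA WB WC : Type*} [AddCommGroup WA] [Module ℂ WA] [AddCommGroup WB] [Module ℂ WB]
  [AddCommGroup WC] [Module ℂ WC]
  (k₁ : M' →+* K) (k₂ : M' →+* M)
  {θA : M →+* Module.End ℂ WA} {θB : K →+* Module.End ℂ WB} {θC : M' →+* Module.End ℂ WC}

omit [NumberField M'] [NumberField M] in
/-- An `M'`-equivariant map from the inflated side `W_B` (acting field `K ⊇ k₁ M'`) to the base side `W_C` carries a
`σ`-eigenvector to a `σ ∘ k₁`-eigenvector. [folklore] -/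
theorem map_mem_eigenline_comp (R : WB →ₗ[ℂ] WC) (hR : ∀ (a : M') (c : WB), R (θB (k₁ a) c) = θC a (R c))
    {σ : K →+* ℂ} {β : WB} (hβ : β ∈ eigenline θB σ) : R β ∈ eigenline θC (σ.comp k₁) := by
  refine (Submodule.mem_iInf _).2 fun a ↦ Module.End.mem_eigenspace_iff.2 ?_
  rw [← hR, eigenline_apply_eq_smul hβ (k₁ a), map_smul, RingHom.comp_apply]

/-- **Factorisation through the base.** Eigenbases `b_A` of `W_A` (field `M`) and `b_C` of `W_C` (field `M'`, eigenlines
of dimension one); `M'`-equivariant maps `P_j : W_C → W_A` (along `k₂`) that are jointly surjective and `R_l : W_B → W_C`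
(along `k₁`) that are jointly injective; a nonzero `σ`-eigenvector `β ∈ W_B`.  Then every `τ`-eigenvector of `W_A` with
`τ ∘ k₂ = σ ∘ k₁` is `Σ_j d_j • P_j (R_l β)` for one `l`. [folklore] -/
theorem eigenline_mem_span_of_factorisation
    (bA : Basis (M →+* ℂ) ℂ WA) (hbA : ∀ τ, bA τ ∈ eigenline θA τ)
    (bC : Basis (M' →+* ℂ) ℂ WC) (hbC : ∀ χ, bC χ ∈ eigenline θC χ)
    (hC1 : ∀ χ, Module.finrank ℂ (eigenline θC χ) = 1)
    {m : ℕ} (P : Fin m → (WC →ₗ[ℂ] WA)) (hP : ∀ (j : Fin m) (a : M') (c : WC), P j (θC a c) = θA (k₂ a) (P j c))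
    (hPsurj : ∀ x : WA, ∃ γ : Fin m → WC, x = ∑ j, P j (γ j))
    {m' : ℕ} (R : Fin m' → (WB →ₗ[ℂ] WC)) (hR : ∀ (l : Fin m') (a : M') (c : WB), R l (θB (k₁ a) c) = θC a (R l c))
    (hRinj : ∀ c : WB, (∀ l, R l c = 0) → c = 0)
    {σ : K →+* ℂ} {β : WB} (hβ : β ∈ eigenline θB σ) (hβ0 : β ≠ 0)
    {τ : M →+* ℂ} (hστ : τ.comp k₂ = σ.comp k₁) {x : WA} (hx : x ∈ eigenline θA τ) :
    ∃ (l : Fin m') (d : Fin m → ℂ), x = ∑ j, d j • P j (R l β) := by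
  classical
  set χ : M' →+* ℂ := σ.comp k₁ with hχ
  -- (1) some `R_l β ≠ 0`; it spans the `χ`-eigenline of `W_C`
  obtain ⟨l, hl⟩ : ∃ l, R l β ≠ 0 := by
    by_contra h
    push Not at h
    exact hβ0 (hRinj β h)
  have hlχ : R l β ∈ eigenline θC χ := map_mem_eigenline_comp k₁ (R l) (hR l) hβ
  obtain ⟨e, he⟩ : ∃ e : ℂ, e • R l β = bC χ := by
    have h1 := (finrank_eq_one_iff_of_nonzero' (⟨R l β, hlχ⟩ : eigenline θC χ)
      (by simpa [ne_eq, Submodule.mk_eq_zero] using hl)).1 (hC1 χ) ⟨bC χ, hbC χ⟩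
    obtain ⟨e, he⟩ := h1
    exact ⟨e, by simpa using congrArg Subtype.val he⟩
  -- (2) `x = Σ_j P_j γ_j`; split `γ_j` into its `χ`-component and the rest
  obtain ⟨γ, hγ⟩ := hPsurj x
  let δ : Fin m → WC := fun j ↦ γ j - bC.repr (γ j) χ • bC χ
  have hδχ : ∀ j, bC.repr (δ j) χ = 0 := fun j ↦ by
    simp [δ, map_sub, map_smul, bC.repr_self, Finsupp.single_eq_same]
  set y : WA := ∑ j, bC.repr (γ j) χ • P j (bC χ) with hy
  set z : WA := ∑ j, P j (δ j) with hz
  have hxyz : x = y + z := by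
    rw [hγ, hy, hz, ← Finset.sum_add_distrib]
    refine Finset.sum_congr rfl fun j _ ↦ ?_
    rw [← map_smul, ← map_add]
    congr 1
    simp only [δ, add_sub_cancel]
  -- supports: `P_j (b_C χ')` has `τ''`-coordinate `0` unless `τ'' ∘ k₂ = χ'`
  have hsuppP : ∀ (j : Fin m) (χ' : M' →+* ℂ) (τ'' : M →+* ℂ), τ''.comp k₂ ≠ χ' →
      bA.repr (P j (bC χ')) τ'' = 0 :=
    fun j χ' τ'' hne ↦ repr_apply_eq_zero_of_comp_ne k₂ (P j) (hP j) bA hbA (hbC χ') hne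
  -- `x` has `τ''`-coordinate `0` for `τ'' ≠ τ`
  have hsuppx : ∀ τ'' : M →+* ℂ, τ'' ≠ τ → bA.repr x τ'' = 0 := fun τ'' hne ↦
    repr_apply_eq_zero_of_comp_ne (RingHom.id M) (θ := θA) (θ' := θA) LinearMap.id (fun a c ↦ rfl)
      bA hbA hx (τ := τ'') (by simpa using hne)
  -- (3) `z = 0`, coordinatewise
  have hzδ : ∀ τ'' : M →+* ℂ, τ''.comp k₂ = χ → bA.repr z τ'' = 0 := by
    intro τ'' hτ''
    rw [hz, map_sum, Finsupp.finsetSum_apply]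
    refine Finset.sum_eq_zero fun j _ ↦ ?_
    -- expand `δ j` in the eigenbasis `b_C`
    have hexp : P j (δ j) = ∑ χ', bC.repr (δ j) χ' • P j (bC χ') := by
      conv_lhs => rw [← bC.sum_repr (δ j)]
      rw [map_sum]
      exact Finset.sum_congr rfl fun χ' _ ↦ by rw [map_smul]
    rw [hexp, map_sum, Finsupp.finsetSum_apply]
    refine Finset.sum_eq_zero fun χ' _ ↦ ?_
    rw [map_smul, Finsupp.smul_apply, smul_eq_mul]
    by_cases hχ' : χ' = χ
    · rw [hχ', hδχ j, zero_mul]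
    · rw [hsuppP j χ' τ'' (by rw [hτ'']; exact Ne.symm hχ'), mul_zero]
  have hy0 : ∀ τ'' : M →+* ℂ, τ''.comp k₂ ≠ χ → bA.repr y τ'' = 0 := by
    intro τ'' hτ''
    rw [hy, map_sum, Finsupp.finsetSum_apply]
    refine Finset.sum_eq_zero fun j _ ↦ ?_
    rw [map_smul, Finsupp.smul_apply, smul_eq_mul, hsuppP j χ τ'' hτ'', mul_zero]
  have hz0 : z = 0 := by
    refine bA.forall_coord_eq_zero_iff.1 fun τ'' ↦ ?_
    rw [Basis.coord_apply]
    by_cases hτ'' : τ''.comp k₂ = χ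
    · exact hzδ τ'' hτ''
    · have hne : τ'' ≠ τ := fun h ↦ hτ'' (by rw [h, hστ])
      have : z = x - y := by rw [hxyz, add_sub_cancel_left]
      rw [this, map_sub, Finsupp.sub_apply, hsuppx τ'' hne, hy0 τ'' hτ'', sub_zero]
  -- (4) assemble
  refine ⟨l, fun j ↦ bC.repr (γ j) χ * e, ?_⟩
  rw [hxyz, hz0, add_zero, hy]
  refine Finset.sum_congr rfl fun j _ ↦ ?_
  rw [← he, map_smul, smul_smul]

end Assembly

/-! ## B. The CM realisations -/

section Realisation

variable {M' K M : Type} [Field M'] [NumberField M'] [Field K] [NumberField K] [Field M] [NumberField M]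
  (k₁ : M' →+* K) (k₂ : M' →+* M) {Φ' : CMType M'}
  {C : AbelianVariety ℂ} {ιC : 𝓞 M' →+* End C} {θC : M' →+* Module.End ℂ (complexBetti C.X 1)}
  {B : AbelianVariety ℂ} {ιB : 𝓞 K →+* End B} {θB : K →+* Module.End ℂ (complexBetti B.X 1)}
  {A : AbelianVariety ℂ} {ιA : 𝓞 M →+* End A} {θA : M →+* Module.End ℂ (complexBetti A.X 1)}

/-- **Eigenlines correspond under `β : ℂ ⊗_ℚ H¹(X; ℚ) ≃ H¹(X; ℂ)`**: the image of the `σ`-eigenline of the complexified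
rational action `complexify (cmAction θ)` is the `σ`-eigenline of `θ` (twin of the vendored
`BettiUniverse.map_eigenspaces_cmEndAction`, without the Hodge-structure wrapper). [folklore] -/
theorem map_eigenline_complexify {g : ℕ} {X : SchemeOver ℂ} (hX : IsSmoothProjective g X)
    {E : Type} [Field E] [NumberField E] (θ : E →+* Module.End ℂ (complexBetti X 1)) (hθ : IsInducedOnIntegers θ)
    (σ : E →+* ℂ) :
    Submodule.map (ofRatClassBaseChangeEquiv hX 1).toLinearMap (eigenline (complexify (cmAction θ hθ)) σ) =
      eigenline θ σ := by
  ext w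
  simp only [Submodule.mem_map, eigenline, Submodule.mem_iInf, Module.End.mem_eigenspace_iff, complexify_apply,
    LinearEquiv.coe_toLinearMap, Literature.AlgebraicGeometry.HodgeTheory.ofRatClassBaseChangeEquiv_apply]
  constructor
  · rintro ⟨t, ht, rfl⟩ a
    rw [← ofRatClassBaseChange_cmAction θ hθ, ht a, map_smul]
  · intro hw
    refine ⟨(ofRatClassBaseChangeEquiv hX 1).symm w, fun a ↦ ?_, ?_⟩
    · apply (ofRatClassBaseChangeEquiv hX 1).injective
      rw [Literature.AlgebraicGeometry.HodgeTheory.ofRatClassBaseChangeEquiv_apply,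
        Literature.AlgebraicGeometry.HodgeTheory.ofRatClassBaseChangeEquiv_apply, ofRatClassBaseChange_cmAction,
        map_smul, ← Literature.AlgebraicGeometry.HodgeTheory.ofRatClassBaseChangeEquiv_apply hX,
        LinearEquiv.apply_symm_apply, hw a]
    · rw [← Literature.AlgebraicGeometry.HodgeTheory.ofRatClassBaseChangeEquiv_apply hX,
        LinearEquiv.apply_symm_apply]

/-- The eigenlines of the complexified rational action of a CM realisation are lines. [folklore] -/
theorem finrank_eigenline_complexify_eq_one {E : Type} [Field E] [NumberField E] {Θ : CMType E}
    {X : AbelianVariety ℂ} {ι : 𝓞 E →+* End X} {θ : E →+* Module.End ℂ (complexBetti X.X 1)}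
    (h : IsCMTypeRealisation Θ X ι θ) (hθ : IsInducedOnIntegers θ) (σ : E →+* ℂ) :
    Module.finrank ℂ (eigenline (complexify (cmAction θ hθ)) σ) = 1 := by
  have h1 := (h.2.2.2 σ).1
  rw [← map_eigenline_complexify h.1 θ hθ σ, LinearEquiv.finrank_map_eq] at h1
  exact h1

/-- An eigenbasis of `ℂ ⊗_ℚ H¹(X(ℂ); ℚ)` for the complexified rational action of a CM realisation. [folklore] -/
theorem exists_basis_mem_eigenline_complexify {E : Type} [Field E] [NumberField E] {Θ : CMType E}
    {X : AbelianVariety ℂ} {ι : 𝓞 E →+* End X} {θ : E →+* Module.End ℂ (complexBetti X.X 1)}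
    (h : IsCMTypeRealisation Θ X ι θ) (hθ : IsInducedOnIntegers θ) :
    ∃ b : Basis (E →+* ℂ) ℂ (ℂ ⊗[ℚ] bettiCohomology X.X 1), ∀ σ, b σ ∈ eigenline (complexify (cmAction θ hθ)) σ := by
  refine exists_basis_mem_eigenline (complexify (cmAction θ hθ)) ?_ (finrank_eigenline_complexify_eq_one h hθ)
  rw [Module.finrank_baseChange, finrank_bettiCohomology_eq h.1 1, h.2.1]

/-- Finite-dimensionality of `H¹(X(ℂ); ℚ)` of a CM realisation. [folklore] -/
theorem finite_bettiCohomology_of_realisation {E : Type} [Field E] [NumberField E] {Θ : CMType E}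
    {X : AbelianVariety ℂ} {ι : 𝓞 E →+* End X} {θ : E →+* Module.End ℂ (complexBetti X.X 1)}
    (h : IsCMTypeRealisation Θ X ι θ) : Module.Finite ℚ (bettiCohomology X.X 1) :=
  Module.finite_of_finrank_pos (by
    rw [finrank_bettiCohomology_eq h.1 1, h.2.1]; exact Module.finrank_pos)

/-- **Joint surjectivity survives complexification** (sum form). [folklore] -/
theorem exists_eq_sum_baseChange_of_bijective {V V' : Type*} [AddCommGroup V] [Module ℚ V] [AddCommGroup V']
    [Module ℚ V'] {m : ℕ} (ψ : Fin m → (V →ₗ[ℚ] V'))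
    (hψ : Function.Bijective (∑ j : Fin m, ψ j ∘ₗ LinearMap.proj j : (Fin m → V) →ₗ[ℚ] V'))
    (t : ℂ ⊗[ℚ] V') : ∃ γ : Fin m → ℂ ⊗[ℚ] V, t = ∑ j, (ψ j).baseChange ℂ (γ j) := by
  induction t using TensorProduct.induction_on with
  | zero => exact ⟨0, by simp⟩
  | tmul c v =>
    obtain ⟨w, hw⟩ := hψ.2 v
    refine ⟨fun j ↦ c ⊗ₜ[ℚ] w j, ?_⟩
    have hw' : ∑ j, ψ j (w j) = v := by
      simpa [LinearMap.sum_apply, LinearMap.comp_apply] using hw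
    simp_rw [LinearMap.baseChange_tmul]
    rw [← TensorProduct.tmul_sum, hw']
  | add t₁ t₂ h₁ h₂ =>
    obtain ⟨γ₁, rfl⟩ := h₁
    obtain ⟨γ₂, rfl⟩ := h₂
    exact ⟨γ₁ + γ₂, by simp [Finset.sum_add_distrib]⟩

/-- **Joint injectivity survives complexification** (family form: a `ℚ`-linear retraction `Σ_l ρ_l ∘ λ_l = id` base-changes
to one over `ℂ`). [folklore] -/
theorem eq_zero_of_forall_baseChange_eq_zero {V V' : Type*} [AddCommGroup V] [Module ℚ V] [AddCommGroup V']
    [Module ℚ V'] {m : ℕ} (lam : Fin m → (V' →ₗ[ℚ] V))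
    (hinj : ∀ v' : V', (∀ l, lam l v' = 0) → v' = 0)
    (t : ℂ ⊗[ℚ] V') (ht : ∀ l, (lam l).baseChange ℂ t = 0) : t = 0 := by
  classical
  -- a rational retraction in sum form
  let Λ : V' →ₗ[ℚ] (Fin m → V) := LinearMap.pi fun l ↦ lam l
  have hker : LinearMap.ker Λ = ⊥ := LinearMap.ker_eq_bot'.2 fun v' hv' ↦
    hinj v' fun l ↦ by simpa [Λ] using congr_fun hv' l
  obtain ⟨g, hg⟩ := LinearMap.exists_leftInverse_of_injective Λ hker
  let ρ : Fin m → (V →ₗ[ℚ] V') := fun l ↦ g ∘ₗ LinearMap.single ℚ (fun _ ↦ V) l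
  have hret : ∀ v' : V', ∑ l, ρ l (lam l v') = v' := by
    intro v'
    have hΛ : Λ v' = ∑ l, Pi.single l (lam l v') := by
      rw [Finset.univ_sum_single]; rfl
    have := LinearMap.congr_fun hg v'
    rw [LinearMap.comp_apply, LinearMap.id_apply, hΛ, map_sum] at this
    simpa [ρ] using this
  -- base change of the retraction, by induction on `t`
  have hretC : ∀ s : ℂ ⊗[ℚ] V', ∑ l, (ρ l).baseChange ℂ ((lam l).baseChange ℂ s) = s := by
    intro s
    induction s using TensorProduct.induction_on with
    | zero => simp
    | tmul c v' =>
      simp_rw [LinearMap.baseChange_tmul]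
      rw [← TensorProduct.tmul_sum, hret]
    | add s₁ s₂ h₁ h₂ => simp_rw [map_add, Finset.sum_add_distrib, h₁, h₂]
  rw [← hretC t]
  exact Finset.sum_eq_zero fun l _ ↦ by rw [ht l, map_zero]


-- port_pkg: scope closed for this part
end Realisation
end HodgeCM.CM.CommonReflex
end
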